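import Summits.ResolutionOfSingularities.ResolutionOfSingularities.Theorems.UniversalCellsMatroidCellResResidueWitnessDimension
import HarnessLib

/-!
# The residue of `UniversalCells.MatroidCellRes` is not vacuous: a singular saturated integral chart of a non-integral Γ-scheme

Fifth and last file of the witness for crux stmt-ResolutionOfSingularities-15230
(`Summit.ResolutionOfSingularities.ResolutionOfSingularities.Theses.UniversalCells.MatroidCellRes`),
line `birth`. The line closes the crux modulo Hu's claim (Hu 2025 Thm. 1.3, INTEGRAL Γ-schemes,
taken by name) and the RESIDUE stub (N) `stub_saturatedEngineNonintegral`: "a singular saturated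
integral principal open `Spec (Q_Γ)_g`, of dimension `≥ 2`, of a NON-integral Γ-scheme
`Z_Γ = Spec Q_Γ` has a resolution" (the part of the crux Hu's printed theorem does not cover). This
file proves that the hypotheses of (N) — and of its dimension-`≥ 4` form — ARE SATISFIED, already
with `m = 4` columns, for every prime `p ≠ 2`: so Hu's Thm. 1.3 as printed does not by itself
close `MatroidCellRes` through the line's reduction; the localised engine is genuinely needed.

The witness is the COMPLETE QUADRILATERAL `A₀ = [[1,1,1,0],[1,1,0,1],[1,0,1,1]]`,
`Γ = {u | x_u(A₀) = 0}`, `g = a₀₀` (files `…ResidueWitnessMinors/Cone/Chart/Dimension.lean`):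

* `not_isDomain_gammaRing` — `Z_Γ` is NOT integral: `a₀₀ · (a₀₁a₁₃a₂₂ - a₁₁a₂₃a₀₂) = 0` in `Q_Γ`
  with both factors non-zero (the second is non-zero at the point `c₀ = 0` of the junk component);
* `isDomain_chart`, `not_isRegularRing_chart` (Chart file) — the chart `D(a₀₀)` is integral and
  singular (it is the quadric cone `a₁₀a₂₃ = a₁₃a₂₀` over `𝔾_m × 𝔸²`);
* `minor_ne_zero_of_not_mem` — `Γ` is saturated on `D(a₀₀)` (evaluate at `A₀`);
* `four_le_ringKrullDim_chart`, `not_topologicalKrullDim_chart_le_three` (Dimension file) — the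
  chart has dimension `≥ 4` (a chain of five primes: kernels of the torus points `A₀ · diag(1, t₀, t₁, t₂)`);
* `residue_hypotheses` (any prime `p ≠ 2`) and `stub_saturatedEngineNonintegral_hypotheses_satisfiable`
  (the conjunction in the exact vocabulary of the registered stub, at `p = 3`).

No definition and no notation is declared. Folklore throughout.
-/

noncomputable section

-- single-problem summit: the doubled namespace component `ResolutionOfSingularities` is forced
set_option linter.dupNamespace false

open MvPolynomial AlgebraicGeometry Literature.AlgebraicGeometry.Resolution

namespace Summit.ResolutionOfSingularities.ResolutionOfSingularities.Theorems.MatroidCellRes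

variable {K : Type} [Field K]

/-! ## `Z_Γ` is not integral -/

/-- **The complete-quadrilateral Γ-scheme is not integral**: in `Q_Γ = K[A] ⧸ (x_u : u ∈ Γ)`,
`a₀₀ · b = 0` for `b = a₀₁a₁₃a₂₂ - a₁₁a₂₃a₀₂` (indeed
`a₀₀b = -a₀₂a₂₃·x_{(e₂,c₀,c₁)} - a₀₁a₁₃·x_{(e₁,c₀,c₂)} - a₀₁a₀₂·x_{(e₀,c₀,c₃)}`), while `a₀₀ ≠ 0`
(evaluate at `A₀`) and `b ≠ 0` (evaluate at the point `[[0,1,0,0],[0,0,0,1],[0,0,1,0]]` of `Z_Γ`,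
on the junk component `c₀ = 0`). [folklore] -/
theorem not_isDomain_gammaRing (h2 : (2 : K) ≠ 0) :
    ¬ IsDomain (HuGamma.ring K 4 {u | aeval (fun ij : Fin 3 × Fin 4 =>
        (![![(1 : K), 1, 1, 0], ![1, 1, 0, 1], ![1, 0, 1, 1]] : Fin 3 → Fin 4 → K) ij.1 ij.2)
          (HuGamma.minor K 4 u) = 0}) := by
  intro hdom
  have memI : ∀ u : Fin 3 → Fin 3 ⊕ Fin 4, aeval (fun ij : Fin 3 × Fin 4 =>
        (![![(1 : K), 1, 1, 0], ![1, 1, 0, 1], ![1, 0, 1, 1]] : Fin 3 → Fin 4 → K) ij.1 ij.2)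
          (HuGamma.minor K 4 u) = 0 →
      HuGamma.minor K 4 u ∈ HuGamma.ideal K 4 {u | aeval (fun ij : Fin 3 × Fin 4 =>
        (![![(1 : K), 1, 1, 0], ![1, 1, 0, 1], ![1, 0, 1, 1]] : Fin 3 → Fin 4 → K) ij.1 ij.2)
          (HuGamma.minor K 4 u) = 0} :=
    fun u hu => Ideal.subset_span ⟨u, hu, rfl⟩
  have m₁ := memI ![Sum.inl 2, Sum.inr 0, Sum.inr 1] (by rw [minor_l₁]; simp)
  have m₂ := memI ![Sum.inl 1, Sum.inr 0, Sum.inr 2] (by rw [minor_l₂]; simp)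
  have m₃ := memI ![Sum.inl 0, Sum.inr 0, Sum.inr 3] (by rw [minor_l₃]; simp)
  rw [minor_l₁] at m₁
  rw [minor_l₂] at m₂
  rw [minor_l₃] at m₃
  -- the certificate
  have key : (X (0, 0) * (X (0, 1) * X (1, 3) * X (2, 2) - X (1, 1) * X (2, 3) * X (0, 2)) :
      MvPolynomial (Fin 3 × Fin 4) K) =
      (-(X (0, 2) * X (2, 3))) * (X (0, 0) * X (1, 1) - X (0, 1) * X (1, 0)) +
      (-(X (0, 1) * X (1, 3))) * (X (0, 2) * X (2, 0) - X (0, 0) * X (2, 2)) +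
      (-(X (0, 1) * X (0, 2))) * (X (1, 0) * X (2, 3) - X (1, 3) * X (2, 0)) := by ring
  have hprod : Ideal.Quotient.mk _ (X (0, 0) : MvPolynomial (Fin 3 × Fin 4) K) *
      Ideal.Quotient.mk (HuGamma.ideal K 4 {u | aeval (fun ij : Fin 3 × Fin 4 =>
        (![![(1 : K), 1, 1, 0], ![1, 1, 0, 1], ![1, 0, 1, 1]] : Fin 3 → Fin 4 → K) ij.1 ij.2)
          (HuGamma.minor K 4 u) = 0})
        (X (0, 1) * X (1, 3) * X (2, 2) - X (1, 1) * X (2, 3) * X (0, 2)) = 0 := by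
    rw [← map_mul, Ideal.Quotient.eq_zero_iff_mem, key]
    refine Ideal.add_mem _ (Ideal.add_mem _ (Ideal.mul_mem_left _ _ m₁) (Ideal.mul_mem_left _ _ m₂))
      (Ideal.mul_mem_left _ _ m₃)
  rcases mul_eq_zero.mp hprod with h | h
  · -- `a₀₀ ≠ 0`: evaluate at `A₀`
    obtain ⟨φ, hφ⟩ := exists_ringHom_gammaRing (S := K) h2
      (![![(1 : K), 1, 1, 0], ![1, 1, 0, 1], ![1, 0, 1, 1]] : Fin 3 → Fin 4 → K)
      (by simp) (by simp) (by simp) (by simp) (by simp) (by simp)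
    have := congrArg φ h
    rw [hφ, aeval_X, map_zero] at this
    simp at this
  · -- `b ≠ 0`: evaluate at the junk point
    obtain ⟨φ, hφ⟩ := exists_ringHom_gammaRing (S := K) h2
      (![![(0 : K), 1, 0, 0], ![0, 0, 0, 1], ![0, 0, 1, 0]] : Fin 3 → Fin 4 → K)
      (by simp) (by simp) (by simp) (by simp) (by simp) (by simp)
    have := congrArg φ h
    rw [hφ, map_zero] at this
    simp only [map_sub, map_mul, aeval_X] at this
    simp at this

/-! ## `Γ` is saturated on the chart `D(a₀₀)` -/

/-- **Saturation**: for `u ∉ Γ` the minor `x_u` is non-zero in the chart ring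
`(Q_Γ)[1/a₀₀]` — its image under the evaluation at `A₀` (which factors through the chart ring,
`a₀₀(A₀) = 1`) is `x_u(A₀) ≠ 0`. [folklore] -/
theorem minor_ne_zero_of_not_mem (h2 : (2 : K) ≠ 0) (u : Fin 3 → Fin 3 ⊕ Fin 4)
    (hu : u ∉ {u : Fin 3 → Fin 3 ⊕ Fin 4 | aeval (fun ij : Fin 3 × Fin 4 =>
        (![![(1 : K), 1, 1, 0], ![1, 1, 0, 1], ![1, 0, 1, 1]] : Fin 3 → Fin 4 → K) ij.1 ij.2)
          (HuGamma.minor K 4 u) = 0}) :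
    algebraMap _ (Localization.Away (Ideal.Quotient.mk (HuGamma.ideal K 4
        {u | aeval (fun ij : Fin 3 × Fin 4 =>
          (![![(1 : K), 1, 1, 0], ![1, 1, 0, 1], ![1, 0, 1, 1]] : Fin 3 → Fin 4 → K) ij.1 ij.2)
            (HuGamma.minor K 4 u) = 0}) (X (0, 0))))
      (Ideal.Quotient.mk (HuGamma.ideal K 4 {u | aeval (fun ij : Fin 3 × Fin 4 =>
          (![![(1 : K), 1, 1, 0], ![1, 1, 0, 1], ![1, 0, 1, 1]] : Fin 3 → Fin 4 → K) ij.1 ij.2)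
            (HuGamma.minor K 4 u) = 0}) (HuGamma.minor K 4 u)) ≠ 0 := by
  obtain ⟨ψ, hψ⟩ := exists_ringHom_away (S := K) h2
    (![![(1 : K), 1, 1, 0], ![1, 1, 0, 1], ![1, 0, 1, 1]] : Fin 3 → Fin 4 → K)
    (by simp) (by simp) (by simp) (by simp) (by simp) (by simp) (by simp)
  intro h0
  have := congrArg ψ h0
  rw [hψ, map_zero] at this
  exact hu this

/-! ## The hypotheses of the residue stub (N) hold -/

/-- `2 ≠ 0` in `ZMod p` for a prime `p ≠ 2`. [folklore] -/
theorem two_ne_zero_zmod (p : ℕ) [hp : Fact p.Prime] (hp2 : p ≠ 2) : (2 : ZMod p) ≠ 0 := by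
  intro h
  have h' : ((2 : ℕ) : ZMod p) = 0 := by exact_mod_cast h
  rw [ZMod.natCast_eq_zero_iff] at h'
  exact hp2 ((Nat.prime_dvd_prime_iff_eq hp.out Nat.prime_two).mp h')

/-- **The hypotheses of the residue (N) are satisfied — every prime `p ≠ 2`, `m = 4`.** For the
complete quadrilateral `A₀` over `𝔽_p`, `Γ = {u | x_u(A₀) = 0}` and `g = a₀₀`: the Γ-ring `Q_Γ`
is NOT a domain, the chart `(Q_Γ)_g` IS a domain, `Γ` is saturated on it, it is NOT a regular ring,
and its dimension is `≥ 4`. So the line's reduction of `MatroidCellRes` invokes the residue (in its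
dimension-`≥ 4` form) on an actual input: Hu's Thm. 1.3 as printed (integral `Z_Γ`) does not close
the crux by itself. [folklore] -/
theorem residue_hypotheses (p : ℕ) [Fact p.Prime] (hp2 : p ≠ 2) :
    ¬ IsDomain (HuGamma.ring (ZMod p) 4 {u | aeval (fun ij : Fin 3 × Fin 4 =>
          (![![(1 : ZMod p), 1, 1, 0], ![1, 1, 0, 1], ![1, 0, 1, 1]] : Fin 3 → Fin 4 → ZMod p)
            ij.1 ij.2) (HuGamma.minor (ZMod p) 4 u) = 0}) ∧
    IsDomain (Localization.Away (Ideal.Quotient.mk (HuGamma.ideal (ZMod p) 4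
        {u | aeval (fun ij : Fin 3 × Fin 4 =>
          (![![(1 : ZMod p), 1, 1, 0], ![1, 1, 0, 1], ![1, 0, 1, 1]] : Fin 3 → Fin 4 → ZMod p)
            ij.1 ij.2) (HuGamma.minor (ZMod p) 4 u) = 0}) (X (0, 0)))) ∧
    (∀ u : Fin 3 → Fin 3 ⊕ Fin 4, u ∉ {u : Fin 3 → Fin 3 ⊕ Fin 4 | aeval (fun ij : Fin 3 × Fin 4 =>
          (![![(1 : ZMod p), 1, 1, 0], ![1, 1, 0, 1], ![1, 0, 1, 1]] : Fin 3 → Fin 4 → ZMod p)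
            ij.1 ij.2) (HuGamma.minor (ZMod p) 4 u) = 0} →
      algebraMap _ (Localization.Away (Ideal.Quotient.mk (HuGamma.ideal (ZMod p) 4
        {u | aeval (fun ij : Fin 3 × Fin 4 =>
          (![![(1 : ZMod p), 1, 1, 0], ![1, 1, 0, 1], ![1, 0, 1, 1]] : Fin 3 → Fin 4 → ZMod p)
            ij.1 ij.2) (HuGamma.minor (ZMod p) 4 u) = 0}) (X (0, 0))))
        (Ideal.Quotient.mk (HuGamma.ideal (ZMod p) 4 {u | aeval (fun ij : Fin 3 × Fin 4 =>
          (![![(1 : ZMod p), 1, 1, 0], ![1, 1, 0, 1], ![1, 0, 1, 1]] : Fin 3 → Fin 4 → ZMod p)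
            ij.1 ij.2) (HuGamma.minor (ZMod p) 4 u) = 0}) (HuGamma.minor (ZMod p) 4 u)) ≠ 0) ∧
    ¬ IsRegularRing (Localization.Away (Ideal.Quotient.mk (HuGamma.ideal (ZMod p) 4
        {u | aeval (fun ij : Fin 3 × Fin 4 =>
          (![![(1 : ZMod p), 1, 1, 0], ![1, 1, 0, 1], ![1, 0, 1, 1]] : Fin 3 → Fin 4 → ZMod p)
            ij.1 ij.2) (HuGamma.minor (ZMod p) 4 u) = 0}) (X (0, 0)))) ∧
    ¬ topologicalKrullDim (Spec (.of (Localization.Away (Ideal.Quotient.mk (HuGamma.ideal (ZMod p) 4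
        {u | aeval (fun ij : Fin 3 × Fin 4 =>
          (![![(1 : ZMod p), 1, 1, 0], ![1, 1, 0, 1], ![1, 0, 1, 1]] : Fin 3 → Fin 4 → ZMod p)
            ij.1 ij.2) (HuGamma.minor (ZMod p) 4 u) = 0}) (X (0, 0)))))) ≤ 3 :=
  ⟨not_isDomain_gammaRing (two_ne_zero_zmod p hp2), isDomain_chart (two_ne_zero_zmod p hp2),
    fun u hu => minor_ne_zero_of_not_mem (two_ne_zero_zmod p hp2) u hu,
    not_isRegularRing_chart (two_ne_zero_zmod p hp2),
    not_topologicalKrullDim_chart_le_three (two_ne_zero_zmod p hp2)⟩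

/-- **The residue stub is not vacuous** — the conjunction of the hypotheses of the registered stub
`stub_saturatedEngineNonintegral` of line `birth` (crux `MatroidCellRes`), in its own vocabulary
(the crux's `let`-bound matrix and ideal written out), together with the dimension-`≥ 4` form of
lead c2's sharper residue: witnessed at `p = 3`, `m = 4`, `Γ = {u | x_u(A₀) = 0}` for the complete
quadrilateral `A₀`, `g = a₀₀`. [folklore] -/
theorem stub_saturatedEngineNonintegral_hypotheses_satisfiable :
    ∃ (p : ℕ) (_ : p.Prime) (m : ℕ) (Γ : Set (Fin 3 → Fin 3 ⊕ Fin m))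
      (g : MvPolynomial (Fin 3 × Fin m) (ZMod p) ⧸ Ideal.span ((fun u : Fin 3 → Fin 3 ⊕ Fin m => ((Matrix.fromCols (1 : Matrix (Fin 3) (Fin 3) (MvPolynomial (Fin 3 × Fin m) (ZMod p))) (Matrix.of fun i j => MvPolynomial.X (i, j))).submatrix id u).det) '' Γ)),
      ¬ IsDomain (MvPolynomial (Fin 3 × Fin m) (ZMod p) ⧸ Ideal.span ((fun u : Fin 3 → Fin 3 ⊕ Fin m => ((Matrix.fromCols (1 : Matrix (Fin 3) (Fin 3) (MvPolynomial (Fin 3 × Fin m) (ZMod p))) (Matrix.of fun i j => MvPolynomial.X (i, j))).submatrix id u).det) '' Γ)) ∧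
      IsDomain (Localization.Away g) ∧
      (∀ u : Fin 3 → Fin 3 ⊕ Fin m, u ∉ Γ →
        algebraMap (MvPolynomial (Fin 3 × Fin m) (ZMod p) ⧸ Ideal.span ((fun u : Fin 3 → Fin 3 ⊕ Fin m => ((Matrix.fromCols (1 : Matrix (Fin 3) (Fin 3) (MvPolynomial (Fin 3 × Fin m) (ZMod p))) (Matrix.of fun i j => MvPolynomial.X (i, j))).submatrix id u).det) '' Γ)) (Localization.Away g)
          (Ideal.Quotient.mk (Ideal.span ((fun u : Fin 3 → Fin 3 ⊕ Fin m => ((Matrix.fromCols (1 : Matrix (Fin 3) (Fin 3) (MvPolynomial (Fin 3 × Fin m) (ZMod p))) (Matrix.of fun i j => MvPolynomial.X (i, j))).submatrix id u).det) '' Γ))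
            ((Matrix.fromCols (1 : Matrix (Fin 3) (Fin 3) (MvPolynomial (Fin 3 × Fin m) (ZMod p))) (Matrix.of fun i j => MvPolynomial.X (i, j))).submatrix id u).det) ≠ 0) ∧
      ¬ IsRegularRing (Localization.Away g) ∧
      ¬ topologicalKrullDim (Spec (.of (Localization.Away g))) ≤ 1 ∧
      ¬ topologicalKrullDim (Spec (.of (Localization.Away g))) ≤ 3 := by
  haveI : Fact (Nat.Prime 3) := ⟨Nat.prime_three⟩
  obtain ⟨h₁, h₂, h₃, h₄, h₅⟩ := residue_hypotheses 3 (by decide)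
  refine ⟨3, Nat.prime_three, 4, _, Ideal.Quotient.mk _ (X (0, 0)), h₁, h₂, h₃, h₄, fun h => h₅ ?_, h₅⟩
  exact h.trans (by norm_num)

end Summit.ResolutionOfSingularities.ResolutionOfSingularities.Theorems.MatroidCellRes

end
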